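import Mathlib
import HarnessLib
import Summits.KontsevichZagierPeriods.KontsevichZagierPeriods.Theses.LinRedNormalForm
import Summits.KontsevichZagierPeriods.KontsevichZagierPeriods.Theorems.LinRedNormalFormDihedralNormalFormStubTorusDescent
import Summits.KontsevichZagierPeriods.KontsevichZagierPeriods.Theorems.LinRedNormalFormDihedralNormalFormStubWordAtomChart
import Summits.KontsevichZagierPeriods.KontsevichZagierPeriods.Theorems.LinRedNormalFormDihedralNormalFormStubAtomReduction
import Summits.KontsevichZagierPeriods.KontsevichZagierPeriods.Theorems.LinRedNormalFormDihedralNormalFormStubRebaseOne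
import Summits.KontsevichZagierPeriods.KontsevichZagierPeriods.Theorems.LinRedNormalFormDihedralNormalFormStubUnnestingThree
import Summits.KontsevichZagierPeriods.KontsevichZagierPeriods.Theorems.LinRedNormalFormDihedralNormalFormStubNestedReduction

/-!
# `DihedralNormalForm` in dimension `≤ 3` (line `torus-descent-sum-shadow`, corollary)

Corollary `dihedralNormalForm_le_three` of the crux `DihedralNormalForm`
(stmt-KontsevichZagierPeriods-3912, route `LinRedNormalForm`): the crux statement with `k ≤ 3`
inserted, UNCONDITIONALLY. Every absolutely convergent genus-zero representation
`[Δ_k, P(t) / (∏ tᵢ^{bᵢ} ∏ (1 - tᵢ)^{cᵢ} ∏_{i<j} (tᵢ - tⱼ)^{aᵢⱼ})]` of dimension `k ≤ 3` — i.e.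
every such period integral of `M_{0,n}`, `n ≤ 6` — is congruent modulo `KZ.relations` (finitely
many instances of Kontsevich–Zagier's rules (1) additivity, (2) change of variables,
(3) Newton–Leibniz, all intermediates absolutely convergent) to a `ℤ`-combination of MZV word
representations `[Δ_w, q · ∏ ω_{εᵢ}(tᵢ)]`.

The proof is the composition of the line's landed stubs, restricted to dimension `≤ 3`:
* ENTRANCE `stub_atomReduction`: the input is congruent to a combination of convergent cubical
  atoms `[□ᵏ, q · xᵃ · ∏_{i ≤ j} (1 - x_{[i,j]})^{e i j}]`;
* strong induction on the dimension `k ≤ 3` (`DimLeThree.atom_red_le_three`): a NON-NESTED atom is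
  unnested by `stub_unnesting_le_three` (nested ∪ SD1-directed ∪ word ∪ lower-dimensional atoms); a
  NESTED atom goes to word ∪ SD1-directed ∪ lower-dimensional atoms by THEOREM N
  `stub_nestedReduction`; an SD1-DIRECTED atom descends one dimension by `stub_torusDescent` and is
  re-cubed by `stub_rebaseOne` (atoms of dimension `≤ k - 1`, induction hypothesis); a WORD atom is a
  word representation read in the cubical chart, `stub_wordAtomChart` (EXIT);
* the generator-wise congruences extend additively to the generated subgroups
  (`DimLeThree.closure_transfer`).
No definitions are introduced: the generator families and the reduction relation are parse-time
notations (`WORDS`, `ATOMS⟪k⟫`, …, `RED⟪S, T⟫`).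

References: M. Kontsevich, D. Zagier, *Periods* (2001), §1.2; F. Brown, *Multiple zeta values and
periods of moduli spaces* `M_{0,n}`, Ann. Sci. ÉNS 42 (2009), Thm 1.1 (the value-level shadow).
-/

noncomputable section

open MeasureTheory Set

namespace Summit.KontsevichZagierPeriods.DihedralNormalForm.TorusDescent

open Literature.NumberTheory.Transcendental

namespace DimLeThree

/-! ### Notation (parse-time abbreviations; no definitions are introduced) -/

set_option quotPrecheck false

/-- The crux's target generators: MZV word representations `[Δ_w, q · ∏ ω_{εᵢ}(tᵢ)]`. -/
local notation "WORDS" =>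
  ({x : Literature.NumberTheory.Transcendental.KZ.FormalRep | ∃ (w : ℕ) (ε : Fin w → Bool) (q : ℚ) (s : Literature.NumberTheory.Transcendental.KZ.IntegralRep w), s.domain = {t | (∀ i, 0 < t i) ∧ (∀ i, t i < 1) ∧ StrictAnti t} ∧ Set.EqOn s.integrand (fun t => (q : ℝ) * ∏ i, if ε i then 1 / (1 - t i) else 1 / t i) s.domain ∧ x = Literature.NumberTheory.Transcendental.KZ.of s} : Set KZ.FormalRep)
/-- Convergent cubical atoms of dimension `k`. -/
local notation "ATOMS⟪" k "⟫" =>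
  ({z : Literature.NumberTheory.Transcendental.KZ.FormalRep | ∃ (q : ℚ) (a : Fin k → ℕ) (e : Fin k → Fin k → ℤ) (s : Literature.NumberTheory.Transcendental.KZ.IntegralRep k), s.domain = {x : Fin k → ℝ | ∀ i, x i ∈ Set.Ioo (0:ℝ) 1} ∧ Set.EqOn s.integrand (fun x => (q : ℝ) * ((∏ i : Fin k, x i ^ a i) * ∏ i : Fin k, ∏ j : Fin k, if i ≤ j then (1 - (∏ l : Fin k, if i ≤ l ∧ l ≤ j then x l else 1)) ^ e i j else 1)) s.domain ∧ z = Literature.NumberTheory.Transcendental.KZ.of s} : Set KZ.FormalRep)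
/-- Atoms of dimension `< k`. -/
local notation "ATOMSLT⟪" k "⟫" =>
  ({z : Literature.NumberTheory.Transcendental.KZ.FormalRep | ∃ d : ℕ, d < k ∧ z ∈ {z : Literature.NumberTheory.Transcendental.KZ.FormalRep | ∃ (q : ℚ) (a : Fin d → ℕ) (e : Fin d → Fin d → ℤ) (s : Literature.NumberTheory.Transcendental.KZ.IntegralRep d), s.domain = {x : Fin d → ℝ | ∀ i, x i ∈ Set.Ioo (0:ℝ) 1} ∧ Set.EqOn s.integrand (fun x => (q : ℝ) * ((∏ i : Fin d, x i ^ a i) * ∏ i : Fin d, ∏ j : Fin d, if i ≤ j then (1 - (∏ l : Fin d, if i ≤ l ∧ l ≤ j then x l else 1)) ^ e i j else 1)) s.domain ∧ z = Literature.NumberTheory.Transcendental.KZ.of s}} : Set KZ.FormalRep)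
/-- Atoms of dimension `≤ k`. -/
local notation "ATOMSLE⟪" k "⟫" =>
  ({z : Literature.NumberTheory.Transcendental.KZ.FormalRep | ∃ d : ℕ, d ≤ k ∧ z ∈ {z : Literature.NumberTheory.Transcendental.KZ.FormalRep | ∃ (q : ℚ) (a : Fin d → ℕ) (e : Fin d → Fin d → ℤ) (s : Literature.NumberTheory.Transcendental.KZ.IntegralRep d), s.domain = {x : Fin d → ℝ | ∀ i, x i ∈ Set.Ioo (0:ℝ) 1} ∧ Set.EqOn s.integrand (fun x => (q : ℝ) * ((∏ i : Fin d, x i ^ a i) * ∏ i : Fin d, ∏ j : Fin d, if i ≤ j then (1 - (∏ l : Fin d, if i ≤ l ∧ l ≤ j then x l else 1)) ^ e i j else 1)) s.domain ∧ z = Literature.NumberTheory.Transcendental.KZ.of s}} : Set KZ.FormalRep)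
/-- Atoms with an `SD1` descent direction. -/
local notation "SDATOMS⟪" k "⟫" =>
  ({z : Literature.NumberTheory.Transcendental.KZ.FormalRep | ∃ (q : ℚ) (a : Fin k → ℕ) (e : Fin k → Fin k → ℤ) (s : Literature.NumberTheory.Transcendental.KZ.IntegralRep k), (∃ lam : Fin k → ℤ, (∀ l : Fin k, lam l = 0 ∨ lam l = 1 ∨ lam l = -1) ∧ (∃ p : Fin k, lam p = -1) ∧ (Finset.univ.filter (fun l : Fin k => lam l = 1)).card ≤ 1 ∧ (∀ i j : Fin k, i ≤ j → e i j ≠ 0 → (∑ l : Fin k, if i ≤ l ∧ l ≤ j then lam l else 0) = 0) ∧ (∑ l : Fin k, lam l * ((a l : ℤ) + 1)) ≠ 0) ∧ s.domain = {x : Fin k → ℝ | ∀ i, x i ∈ Set.Ioo (0:ℝ) 1} ∧ Set.EqOn s.integrand (fun x => (q : ℝ) * ((∏ i : Fin k, x i ^ a i) * ∏ i : Fin k, ∏ j : Fin k, if i ≤ j then (1 - (∏ l : Fin k, if i ≤ l ∧ l ≤ j then x l else 1)) ^ e i j else 1)) s.domain ∧ z = Literature.NumberTheory.Transcendental.KZ.of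 s} : Set KZ.FormalRep)
/-- Nested atoms. -/
local notation "NATOMS⟪" k "⟫" =>
  ({z : Literature.NumberTheory.Transcendental.KZ.FormalRep | ∃ (q : ℚ) (a : Fin k → ℕ) (e : Fin k → Fin k → ℤ) (s : Literature.NumberTheory.Transcendental.KZ.IntegralRep k), (∀ i j i' j' : Fin k, i < j → i' < j' → e i j ≠ 0 → e i' j' ≠ 0 → (i ≤ i' ∧ j' ≤ j) ∨ (i' ≤ i ∧ j ≤ j')) ∧ s.domain = {x : Fin k → ℝ | ∀ i, x i ∈ Set.Ioo (0:ℝ) 1} ∧ Set.EqOn s.integrand (fun x => (q : ℝ) * ((∏ i : Fin k, x i ^ a i) * ∏ i : Fin k, ∏ j : Fin k, if i ≤ j then (1 - (∏ l : Fin k, if i ≤ l ∧ l ≤ j then x l else 1)) ^ e i j else 1)) s.domain ∧ z = Literature.NumberTheory.Transcendental.KZ.of s} : Set KZ.FormalRep)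
/-- Word atoms. -/
local notation "WATOMS⟪" k "⟫" =>
  ({z : Literature.NumberTheory.Transcendental.KZ.FormalRep | ∃ (q : ℚ) (ε : Fin k → Bool) (s : Literature.NumberTheory.Transcendental.KZ.IntegralRep k), s.domain = {x : Fin k → ℝ | ∀ i, x i ∈ Set.Ioo (0:ℝ) 1} ∧ Set.EqOn s.integrand (fun x => (q : ℝ) * ((∏ i : Fin k, x i ^ (k - 1 - (i : ℕ))) * ∏ i : Fin k, if ε i then 1 / (1 - (∏ l : Fin k, if l ≤ i then x l else 1)) else 1 / (∏ l : Fin k, if l ≤ i then x l else 1))) s.domain ∧ z = Literature.NumberTheory.Transcendental.KZ.of s} : Set KZ.FormalRep)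
/-- Generator-wise reduction modulo `KZ.relations` of the family `S` onto the family `T`. -/
local notation "RED⟪" S ", " T "⟫" =>
  (∀ x ∈ (S : Set KZ.FormalRep), ∃ c ∈ AddSubgroup.closure (T : Set KZ.FormalRep), x - c ∈ KZ.relations)

set_option quotPrecheck true

/-! ### Reduction modulo relations: closure and gluing -/

/-- Additive extension of a generator-wise reduction to the generated subgroup. -/
theorem closure_transfer {S T : Set KZ.FormalRep} (h : RED⟪S, T⟫) :
    ∀ x ∈ AddSubgroup.closure S, ∃ c ∈ AddSubgroup.closure T, x - c ∈ KZ.relations := by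
  intro x hx
  induction hx using AddSubgroup.closure_induction with
  | mem x hx => exact h x hx
  | zero => exact ⟨0, zero_mem _, by simp⟩
  | add x y _ _ ihx ihy =>
    obtain ⟨m₁, hm₁, h₁⟩ := ihx
    obtain ⟨m₂, hm₂, h₂⟩ := ihy
    refine ⟨m₁ + m₂, add_mem hm₁ hm₂, ?_⟩
    have key := add_mem h₁ h₂
    rwa [show x - m₁ + (y - m₂) = x + y - (m₁ + m₂) by abel] at key
  | neg x _ ih =>
    obtain ⟨m, hm, h⟩ := ih
    refine ⟨-m, neg_mem hm, ?_⟩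
    have key := neg_mem h
    rwa [show -(x - m) = -x - -m by abel] at key

/-- Reductions glue along unions of sources. -/
theorem red_union {S T U : Set KZ.FormalRep} (h₁ : RED⟪S, U⟫) (h₂ : RED⟪T, U⟫) :
    RED⟪S ∪ T, U⟫ := by
  rintro x (hx | hx)
  · exact h₁ x hx
  · exact h₂ x hx

/-- One congruence step: if `x - y ∈ relations` and `y` reduces, so does `x`. -/
theorem red_of_sub_mem {T : Set KZ.FormalRep} {x y : KZ.FormalRep} (hxy : x - y ∈ KZ.relations)
    (hy : ∃ c ∈ AddSubgroup.closure T, y - c ∈ KZ.relations) :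
    ∃ c ∈ AddSubgroup.closure T, x - c ∈ KZ.relations := by
  obtain ⟨c, hc, hyc⟩ := hy
  refine ⟨c, hc, ?_⟩
  have key := add_mem hxy hyc
  rwa [sub_add_sub_cancel] at key

/-! ### The nodes of the composition -/

/-- EXIT: word atoms reduce to the crux's word representations (`stub_wordAtomChart`). -/
theorem wAtom_red (k : ℕ) : RED⟪WATOMS⟪k⟫, WORDS⟫ := by
  rintro z ⟨q, ε, s, hdom, hint, rfl⟩
  exact stub_wordAtomChart k q ε s hdom hint

/-- A global bound on the number of `+1` coordinates bounds it inside every chord. -/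
theorem card_filter_chord_le {n : ℕ} (lam : Fin n → ℤ) (i j : Fin n)
    (h : (Finset.univ.filter (fun l : Fin n => lam l = 1)).card ≤ 1) :
    (Finset.univ.filter (fun l : Fin n => i ≤ l ∧ l ≤ j ∧ lam l = 1)).card ≤ 1 := by
  refine le_trans (Finset.card_le_card ?_) h
  intro l
  simp only [Finset.mem_filter, Finset.mem_univ, true_and]
  exact fun hl => hl.2.2

/-- SD1-directed atoms of dimension `k` reduce to words, given the induction hypothesis in all
dimensions `< k`: torus descent (`stub_torusDescent`) and re-cubing (`stub_rebaseOne`). -/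
theorem sd1Atom_red (k : ℕ) (IH : ∀ d < k, RED⟪ATOMS⟪d⟫, WORDS⟫) :
    RED⟪SDATOMS⟪k⟫, WORDS⟫ := by
  rintro z ⟨q, a, e, s, ⟨lam, hlam, hp, hcard, hch, hE⟩, hdom, hint, rfl⟩
  cases k with
  | zero =>
    obtain ⟨p, -⟩ := hp
    exact p.elim0
  | succ k =>
    have hch' : ∀ i j : Fin (k + 1), i ≤ j → e i j ≠ 0 →
        (∑ l : Fin (k + 1), if i ≤ l ∧ l ≤ j then lam l else 0) = 0 ∧
        (Finset.univ.filter (fun l : Fin (k + 1) => i ≤ l ∧ l ≤ j ∧ lam l = 1)).card ≤ 1 :=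
      fun i j hij he => ⟨hch i j hij he, card_filter_chord_le lam i j hcard⟩
    obtain ⟨B, hB, hrel⟩ := stub_torusDescent k q a e lam s hdom hint hlam hp hch' hE
    obtain ⟨m, hm, hBm⟩ := stub_rebaseOne k
      (q / (((∑ l : Fin (k + 1), lam l * ((a l : ℤ) + 1)) : ℤ) : ℚ)) a e lam B hlam hp hcard hch' hE hB
    have hLE : RED⟪ATOMSLE⟪k⟫, WORDS⟫ := by
      rintro x ⟨d, hd, hx⟩
      exact IH d (Nat.lt_succ_of_le hd) x hx
    exact red_of_sub_mem hrel (red_of_sub_mem hBm (closure_transfer hLE m hm))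

/-- Atoms of dimension `< k` reduce, given the induction hypothesis. -/
theorem atomLT_red (k : ℕ) (IH : ∀ d < k, RED⟪ATOMS⟪d⟫, WORDS⟫) : RED⟪ATOMSLT⟪k⟫, WORDS⟫ := by
  rintro x ⟨d, hd, hx⟩
  exact IH d hd x hx

/-- NESTED atoms of dimension `k` reduce to words, given the induction hypothesis: THEOREM N
(`stub_nestedReduction`) on top of `wAtom_red`, `sd1Atom_red`, `atomLT_red`. -/
theorem nAtom_red (k : ℕ) (IH : ∀ d < k, RED⟪ATOMS⟪d⟫, WORDS⟫) : RED⟪NATOMS⟪k⟫, WORDS⟫ := by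
  rintro z ⟨q, a, e, s, hN, hdom, hint, rfl⟩
  obtain ⟨m, hm, hsm⟩ := stub_nestedReduction k q a e s hdom hint hN
  have h3 : RED⟪WATOMS⟪k⟫ ∪ SDATOMS⟪k⟫ ∪ ATOMSLT⟪k⟫, WORDS⟫ :=
    red_union (red_union (wAtom_red k) (sd1Atom_red k IH)) (atomLT_red k IH)
  exact red_of_sub_mem hsm (closure_transfer h3 m hm)

/-- Every atom of dimension `k ≤ 3` reduces to words: strong induction on the dimension;
non-nested atoms are unnested first (`stub_unnesting_le_three`), nested ones go through
`nAtom_red`. -/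
theorem atom_red_le_three : ∀ k : ℕ, k ≤ 3 → RED⟪ATOMS⟪k⟫, WORDS⟫ := by
  intro k
  induction k using Nat.strong_induction_on with
  | _ k IH =>
    intro hk
    have IH' : ∀ d < k, RED⟪ATOMS⟪d⟫, WORDS⟫ := fun d hd => IH d hd (le_trans hd.le hk)
    rintro z ⟨q, a, e, s, hdom, hint, rfl⟩
    by_cases hN : (∀ i j i' j' : Fin k, i < j → i' < j' → e i j ≠ 0 → e i' j' ≠ 0 →
        (i ≤ i' ∧ j' ≤ j) ∨ (i' ≤ i ∧ j ≤ j'))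
    · exact nAtom_red k IH' _ ⟨q, a, e, s, hN, hdom, hint, rfl⟩
    · have h4 : RED⟪NATOMS⟪k⟫ ∪ SDATOMS⟪k⟫ ∪ WATOMS⟪k⟫ ∪ ATOMSLT⟪k⟫, WORDS⟫ :=
        red_union (red_union (red_union (nAtom_red k IH') (sd1Atom_red k IH')) (wAtom_red k))
          (atomLT_red k IH')
      obtain ⟨m, hm, hsm⟩ := stub_unnesting_le_three k q a e s hk hdom hint hN
      exact red_of_sub_mem hsm (closure_transfer h4 m hm)

end DimLeThree

/-- **`DihedralNormalForm` in dimension `≤ 3`** (corollary of the line `torus-descent-sum-shadow`,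
unconditional). Every absolutely convergent genus-zero representation of dimension `k ≤ 3` on the
open ordered simplex — every period integral of `M_{0,n}`, `n ≤ 6`, in simplicial coordinates — is
congruent modulo `KZ.relations` to a `ℤ`-combination of MZV word representations: reduce the input
to convergent cubical atoms (`stub_atomReduction`), then every atom of dimension `≤ 3` to words
(`DimLeThree.atom_red_le_three`: unnesting in dimension `≤ 3`, Theorem N, torus descent, re-cubing,
the word-atom chart), and extend additively. [cite: KontsevichZagier2001, §1.2] -/
theorem dihedralNormalForm_le_three : ∀ (k : ℕ), k ≤ 3 → ∀ (r : Literature.NumberTheory.Transcendental.KZ.IntegralRep k) (p : MvPolynomial (Fin k) ℚ) (a : Fin k → Fin k → ℕ) (b c : Fin k → ℕ), r.domain = {t | (∀ i, 0 < t i) ∧ (∀ i, t i < 1) ∧ StrictAnti t} → Set.EqOn r.integrand (fun t => MvPolynomial.aeval t p / ((∏ i, t i ^ b i) * (∏ i, (1 - t i) ^ c i) * ∏ i, ∏ j, if i < j then (t i - t j) ^ a i j else 1)) r.domain → ∃ m ∈ AddSubgroup.closure {x : Literature.NumberTheory.Transcendental.KZ.FormalRep | ∃ (w : ℕ) (ε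 : Fin w → Bool) (q : ℚ) (s : Literature.NumberTheory.Transcendental.KZ.IntegralRep w), s.domain = {t | (∀ i, 0 < t i) ∧ (∀ i, t i < 1) ∧ StrictAnti t} ∧ Set.EqOn s.integrand (fun t => (q : ℝ) * ∏ i, if ε i then 1 / (1 - t i) else 1 / t i) s.domain ∧ x = Literature.NumberTheory.Transcendental.KZ.of s}, Literature.NumberTheory.Transcendental.KZ.of r - m ∈ Literature.NumberTheory.Transcendental.KZ.relations := by
  intro k hk r p a b c hdom hint
  obtain ⟨m, hm, hrm⟩ := stub_atomReduction k r p a b c hdom hint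
  exact DimLeThree.red_of_sub_mem hrm
    (DimLeThree.closure_transfer (DimLeThree.atom_red_le_three k hk) m hm)

end Summit.KontsevichZagierPeriods.DihedralNormalForm.TorusDescent
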